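import Summits.BirchSwinnertonDyer.BirchSwinnertonDyer.Theses.KatoDescentPotSupersingular
import Literature.NumberTheory.EllipticCurves.Kato2004.IwasawaCohomologyExistsProofs
import HarnessLib

/-!
# K9 `KatoDescentPotSupersingular`: the held published input `PublishedInputIwasawaH1DataRed`
# (item stmt-BirchSwinnertonDyer-19700, child of crux U₀-red 19190 `WildUpperReducibleDefect`)

Seat `bsd-potss-rkm` (prover, cell `bsd-potss`).  The split child 19700 of crux U₀-red (19190) is the
(`Sort 0`-ascribed) alias of the named Literature fact `Kato2004.nonempty_iwasawaH1Data` (Kato 2004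
§12.2 (12.2.1): the Iwasawa cohomology `𝐇¹_Γ(T_pW)` exists as a `Λ`-module), which is PROVED in the
kernel by `Kato2004.nonempty_iwasawaH1Data_holds`
(`Literature/…/Kato2004/IwasawaCohomologyExistsProofs.lean`: Weierstrass division by
`ω_n = (X+1)^{p^n} − 1` + `conj_γ^{p^n} = 1` on `H¹(ℚ_n, T_pW)`).  Hence the K9 route loses this
cite-level input: the glue `WildUpperReducibleDefectOfCountInputs` (19711, closed) keeps five held inputs
(modularity 19701, the COUNT fact 19707, isogeny invariance of the BSD quotient 19708, rank =
analytic rank 19709, entire `L`-function 19710).  HONEST FRAMING: a construction fact with no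
arithmetic content; closes rung leaf 19700 of BirchSwinnertonDyer, never summit credit; BSD is not
advanced by it.
-/

set_option linter.dupNamespace false

namespace Summit.BirchSwinnertonDyer.BirchSwinnertonDyer.Theorems

/-- **Item 19700 (K9 decl) proved**: `PublishedInputIwasawaH1DataRed` — by name the Literature theorem
`Kato2004.nonempty_iwasawaH1Data_holds`. [cite: Kato2004Asterisque, §12.2 (12.2.1) (p. 220)] -/
theorem publishedInputIwasawaH1DataRed_proof :
    Summit.BirchSwinnertonDyer.BirchSwinnertonDyer.Theses.KatoDescentPotSupersingular.PublishedInputIwasawaH1DataRed :=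
  Literature.NumberTheory.EllipticCurves.Kato2004.nonempty_iwasawaH1Data_holds

end Summit.BirchSwinnertonDyer.BirchSwinnertonDyer.Theorems
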